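import Summits.Ventures.PercRepro.GenQTopTraceGen

/-!
# PercRepro — the top-trace classes at every corank `13 … 17` (night-4, gen 15)

On an `n`-point coloop-free set `G` of the core with `20 ≤ n ≤ 24` the pair `(h_{n−2}, h_{n−3})` of top trace counts
falls into one of SIX classes, and the class fixes the smaller counts:
`(3, 0, …, 0)` (no `s`-trace for `14 ≤ s ≤ n−3`), `(2, 0, …, 0)` (none for `15 ≤ s ≤ n−3`), `(1, 0)`, `(1, 1)`,
`(1, 2, 0, …, 0)` (none for `15 ≤ s ≤ n−4`), `(0, ≤ 4)`.  The caps come from the pencil lemma (`pencil_hypTr_mul_le`: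
`3(n−2) − 2n = n − 6 > 10` and `f* = n − 3 ≤ 21`, so `h_{n−2} ≤ 3`; `3(n−3) − 2n = n − 9 > 10`, `f* = n − 4`, so
`h_{n−3} ≤ 4`), the zeros from the general top-trace lemmas of `GenQTopTraceGen`.  This is the case split of the
corank-`13 … 16` compositions (`jq_t6_nonneg_c13…c16_q7_m0_two_level`) stated once: every class certificate of those
coranks is an LP on one of these six classes.
-/
namespace PercRepro.Night4

open Finset ThmH SixFour GenQ PerFlat Star

variable {α : Type*} [DecidableEq α] {M : Matroid α} [M.Finite]

/-- The pencil cap on the `(n−2)`-traces for `17 ≤ n ≤ 24`: `h_{n−2} ≤ 3`. -/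
theorem hypTr_top_le_three (hs : Simple M) (hline : ∀ L ∈ flatsQ M 2, L.card ≤ 3)
    (hplane : ∀ P ∈ flatsQ M 3, P.card ≤ 6) (hsolid : ∀ F ∈ flatsQ M 4, F.card ≤ 10)
    (hflat5 : ∀ F ∈ flatsQ M 5, F.card ≤ 21) {G : Finset α} {n : ℕ} (hcard : G.card = n) (hn : 17 ≤ n)
    (hn' : n ≤ 24) : hypTr M G 6 (n - 2) ≤ 3 := by
  have hB := flats_le_four_card_le_ten hs hline hplane hsolid
  rcases Nat.lt_or_ge (hypTr M G 6 (n - 2)) 2 with h | h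
  · omega
  · have hpm := pencil_hypTr_mul_le (G := G) (q := 7) (s := n - 2) (B := 10) (B₂ := 21) (by norm_num) hB hflat5
      (by omega) h
    have hmin : min 21 (n - 2 - 1) = n - 3 := by
      rw [Nat.min_eq_right (by omega)]
      omega
    change hypTr M G 6 (n - 2) * (n - 2 - min 21 (n - 2 - 1)) ≤ G.card - min 21 (n - 2 - 1) at hpm
    rw [hmin, show n - 2 - (n - 3) = 1 by omega, mul_one] at hpm
    omega

/-- The pencil cap on the `(n−3)`-traces for `20 ≤ n ≤ 25`: `h_{n−3} ≤ 4`. -/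
theorem hypTr_next_le_four (hs : Simple M) (hline : ∀ L ∈ flatsQ M 2, L.card ≤ 3)
    (hplane : ∀ P ∈ flatsQ M 3, P.card ≤ 6) (hsolid : ∀ F ∈ flatsQ M 4, F.card ≤ 10)
    (hflat5 : ∀ F ∈ flatsQ M 5, F.card ≤ 21) {G : Finset α} {n : ℕ} (hcard : G.card = n) (hn : 20 ≤ n)
    (hn' : n ≤ 25) : hypTr M G 6 (n - 3) ≤ 4 := by
  have hB := flats_le_four_card_le_ten hs hline hplane hsolid
  rcases Nat.lt_or_ge (hypTr M G 6 (n - 3)) 2 with h | h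
  · omega
  · have hpm := pencil_hypTr_mul_le (G := G) (q := 7) (s := n - 3) (B := 10) (B₂ := 21) (by norm_num) hB hflat5
      (by omega) h
    have hmin : min 21 (n - 3 - 1) = n - 4 := by
      rw [Nat.min_eq_right (by omega)]
      omega
    change hypTr M G 6 (n - 3) * (n - 3 - min 21 (n - 3 - 1)) ≤ G.card - min 21 (n - 3 - 1) at hpm
    rw [hmin, show n - 3 - (n - 4) = 1 by omega, mul_one] at hpm
    omega

/-- **The six top-trace classes at `20 ≤ n ≤ 24`**: `(h_{n−2}, h_{n−3})` is `(3, 0)` with no `s`-trace for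
`14 ≤ s ≤ n−3`, or `(2, 0)` with none for `15 ≤ s ≤ n−3`, or `(1, 0)`, or `(1, 1)`, or `(1, 2)` with none for
`15 ≤ s ≤ n−4`, or `(0, ≤ 4)`. -/
theorem top_trace_classes (hs : Simple M) (hline : ∀ L ∈ flatsQ M 2, L.card ≤ 3)
    (hplane : ∀ P ∈ flatsQ M 3, P.card ≤ 6) (hsolid : ∀ F ∈ flatsQ M 4, F.card ≤ 10)
    (hflat5 : ∀ F ∈ flatsQ M 5, F.card ≤ 21) {G : Finset α} {n : ℕ} (hG : G ⊆ gr M) (hcard : G.card = n)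
    (hn : 20 ≤ n) (hn' : n ≤ 24) :
    (hypTr M G 6 (n - 2) = 3 ∧ ∀ s, 14 ≤ s → s + 3 ≤ n → hypTr M G 6 s = 0) ∨
    (hypTr M G 6 (n - 2) = 2 ∧ ∀ s, 15 ≤ s → s + 3 ≤ n → hypTr M G 6 s = 0) ∨
    (hypTr M G 6 (n - 2) = 1 ∧ hypTr M G 6 (n - 3) = 0) ∨
    (hypTr M G 6 (n - 2) = 1 ∧ hypTr M G 6 (n - 3) = 1) ∨
    (hypTr M G 6 (n - 2) = 1 ∧ hypTr M G 6 (n - 3) = 2 ∧ ∀ s, 15 ≤ s → s + 4 ≤ n → hypTr M G 6 s = 0) ∨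
    (hypTr M G 6 (n - 2) = 0 ∧ hypTr M G 6 (n - 3) ≤ 4) := by
  have hT := hypTr_top_le_three hs hline hplane hsolid hflat5 hcard (by omega) hn'
  have hN := hypTr_next_le_four hs hline hplane hsolid hflat5 hcard hn (by omega)
  rcases (show hypTr M G 6 (n - 2) = 0 ∨ hypTr M G 6 (n - 2) = 1 ∨ hypTr M G 6 (n - 2) = 2 ∨
      hypTr M G 6 (n - 2) = 3 by omega) with h0 | h1 | h2 | h3
  · exact Or.inr (Or.inr (Or.inr (Or.inr (Or.inr ⟨h0, hN⟩))))
  · have hle : hypTr M G 6 (n - 3) ≤ 2 :=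
      hypTr_le_two_of_top_pos hs hline hplane hsolid hcard (by omega) (by omega) (by omega)
    rcases (show hypTr M G 6 (n - 3) = 0 ∨ hypTr M G 6 (n - 3) = 1 ∨ hypTr M G 6 (n - 3) = 2 by omega)
      with hn0 | hn1 | hn2
    · exact Or.inr (Or.inr (Or.inl ⟨h1, hn0⟩))
    · exact Or.inr (Or.inr (Or.inr (Or.inl ⟨h1, hn1⟩)))
    · refine Or.inr (Or.inr (Or.inr (Or.inr (Or.inl ⟨h1, hn2, fun s hs15 hsn => ?_⟩))))
      exact hypTr_eq_zero_of_top_pos_two_le_next hs hline hplane hsolid hcard hs15 hsn (by omega) (by omega)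
  · refine Or.inr (Or.inl ⟨h2, fun s hs15 hsn => ?_⟩)
    exact hypTr_eq_zero_of_two_le_top hs hline hplane hsolid hG hcard hs15 hsn (by omega)
  · refine Or.inl ⟨h3, fun s hs14 hsn => ?_⟩
    exact hypTr_eq_zero_of_three_le_top hs hline hplane hsolid hG hcard hs14 hsn (by omega)

end PercRepro.Night4
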